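import Summits.BirchSwinnertonDyer.BirchSwinnertonDyer.Theorems.GenusKolyvaginAtTwoGenusPrimitiveSupplyAtTwoTwistLocalCondition
import Literature.NumberTheory.EllipticCurves.KummerSelmerStructure
import HarnessLib

/-!
# Route `GenusKolyvaginAtTwo`, crux #2 `GenusPrimitiveSupplyAtTwo` (stmt-BirchSwinnertonDyer-22136):
# Mazur–Rubin Lemma 2.10 (i) in the SELMER-STRUCTURE currency of the tree's Poitou–Tate machinery —
# at a place where `d` is a square the local Kummer conditions `𝓛_{E^{(d)},v}` and `𝓛_{E,v}` correspond

Width seat `bsd-line-gk2-p5` g8 (cell `bsd-f1-sign2`, SUPPLY lineage), sequel of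
`…GenusPrimitiveSupplyAtTwoTwistLocalCondition` (p618532). THEOREMS ONLY (no definition, no named fact,
no `sorry`); helper `--supports stmt-BirchSwinnertonDyer-22136`; no item is closed; BSD is not proved by any of this.

WHY. The tree already contains, under the names of cell `b2b-bsdres` (X11b), the Mazur–Rubin 2010 §3 machinery for
a CONGRUENT pair `Y[p] ≅ E[p]` on the Selmer-structure side (`DiscreteGaloisModule.SelmerStructure`,
`WeierstrassCurve.kummerSelmerStructure`, `kummerLocalConditionAt`; the sandwich `H¹_{𝓚_S} ≤ H¹_𝓐 ≤ H¹_{𝓚^S}`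
`X11b.CongruentTransfer.selmerGroup_sandwich_of_agree`, the transport `natCard_selmerGroup_of_transport`, the
one-place Poitou–Tate count `relIndex_kummerStrict_kummerRelaxed_singleton_eq_of_facts`, the transversality
exclusion, and the local agreement at good unramified places `transport_kummer_inr_eq_of_good`), whose per-pair
input is the LOCAL AGREEMENT `(𝓛_{Y,v}).map H¹(φ_v) = 𝓛_{E,v}` of the transported Kummer conditions at the
finitely many remaining places — and whose docstring records that «the local lemma AT `p` … is NOT in the tree».
For `p = 2` and `Y = E^{(d)}` (Mazur–Rubin's twist, Remark 2.4) at a place where `d` is a square — in the cell's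
twisting fields: the prime `2` itself (`d ≡ 1 (mod 8)`), every prime of bad reduction, every Heegner prime — that
local lemma is Mazur–Rubin's Lemma 2.10 (i), and this file proves it in exactly X11b's currency:

* `exists_addEquiv_geomTorsion_two_localSquare_of_sq` — the intertwined pair behind p618532, exported: a
  `Γ_K`-equivariant `ψ : Wd[2] ≃+ W[2]` and, at every `K`-field `E` with `d ∈ (E^×)²`, a `Γ_E`-equivariant
  `θ_E : Wd(K̄_E) ≃+ W(K̄_E)` with `ι_* ∘ ψ = θ_E ∘ ι_*` on `Wd[2]`;
* `exists_intertwining_map_kummerLocalConditionAt_eq_of_sq` — **intertwining isomorphisms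
  `φ : Wd[2] ⟶ W[2]`, `φ' : W[2] ⟶ Wd[2]` (`φ' ∘ φ = id`, `φ ∘ φ' = id`) such that for EVERY `K`-field `E` in
  which `d` is a square, `(Wd.kummerLocalConditionAt 2 E).map H¹(φ|_{Γ_E}) = W.kummerLocalConditionAt 2 E`** —
  the hypothesis `hcheck`/`hagree` of X11b's transfer at such places, for the Kummer structure of `E^{(d)}`
  transported along `φ` (`h𝓐 : 𝓐 v = (Wd.kummerSelmerStructure 2 v).map H¹(φ_v)`).

References: [MazurRubin2010] Remark 2.4, Lemma 2.10 (i), Def. 3.1; [SilvermanAEC2009] X.5 Cor. 5.4, X.§4;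
[MilneADT2006] I.§6 (6.14).
-/

set_option linter.dupNamespace false -- tree convention: `Summit.BirchSwinnertonDyer.BirchSwinnertonDyer.Theorems` (summit = sub-problem)
set_option autoImplicit false

noncomputable section

open scoped Classical ContRepresentation

namespace Summit.BirchSwinnertonDyer.BirchSwinnertonDyer.Theorems.GenusKolyTwistLocal

open WeierstrassCurve Field
open Literature.NumberTheory.EllipticCurves Literature.NumberTheory.GaloisRepresentations

universe u

/-! ## §6 The intertwined pair (global untwisting on `2`-torsion, local untwisting) — exported -/

section LocalSquare

variable {K : Type u} [Field K] [NeZero (2 : K)]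

/-- **The intertwined untwistings, exported.** For `W/K` (`2 ≠ 0`), `d ≠ 0`, `Wd = C • W^{(d)}`: a
`Γ_K`-equivariant `ψ : Wd[2] ≃+ W[2]` (untwisting over `K̄` restricted to `2`-torsion) such that at every `K`-field `E`
with `d = s²` in `E` there is a `Γ_E`-EQUIVARIANT `θ_E : Wd(K̄_E) ≃+ W(K̄_E)` (untwisting over `K̄_E` with `u = ι θ`,
`ι θ = ± s`) with `ι_*(ψ t) = θ_E(ι_* t)` for all `t ∈ Wd[2]` (the square behind
`exists_h1Equiv_selmerLocalKer_iff_of_sq`). [cite: SilvermanAEC2009, X.5 Cor. 5.4] [cite: MazurRubin2010, Remark 2.4] -/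
theorem exists_addEquiv_geomTorsion_two_localSquare_of_sq (W : WeierstrassCurve K) {d : K} (hd : d ≠ 0)
    {Wd : WeierstrassCurve K} {C : VariableChange K} (hWd : C • W.quadraticTwist d = Wd) :
    ∃ (ψ : geomTorsion Wd (2 : ℤ) ≃+ geomTorsion W (2 : ℤ)),
      (∀ (g : absoluteGaloisGroup K) (t : geomTorsion Wd (2 : ℤ)), ψ (g • t) = g • ψ t) ∧
      ∀ (E : Type u) [Field E] [Algebra K E], (∃ s : E, s ^ 2 = algebraMap K E d) →
        ∃ θ : localPoints Wd E ≃+ localPoints W E,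
          (∀ (σ : absoluteGaloisGroup E) (Q : localPoints Wd E), θ (σ • Q) = σ • θ Q) ∧
            ∀ t : geomTorsion Wd (2 : ℤ),
              pointsMap W E (ψ t : geomPoints W) = θ (pointsMap Wd E (t : geomPoints Wd)) := by
  letI : Invertible (2 : K) := invertibleOfNonzero two_ne_zero
  set C₀ : VariableChange K := W.toCharNeTwoNF with hC₀
  set V : WeierstrassCurve K := C₀ • W with hVdef
  haveI : V.IsCharNeTwoNF := by rw [hVdef, hC₀]; infer_instance
  have hV : C₀ • W = V := rfl
  have hVW : W.quadraticTwist d = V.quadraticTwist d := by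
    rw [hVdef, quadraticTwist_smul]
    have h1 : (⟨C₀.u, d * C₀.r, 0, 0⟩ : VariableChange K) = 1 := by
      simp only [hC₀, toCharNeTwoNF, mul_zero]
      rfl
    rw [h1, one_smul]
  set eG : geomPoints Wd ≃+ geomPoints W :=
    (((twistPointsIso hWd).symm.trans (geomPointsCongr hVW)).trans (untwistEquiv V hd)).trans
      (twistPointsIso hV).symm with heG
  have hsign : ∀ (g : absoluteGaloisGroup K) (Q : geomPoints Wd),
      eG (g • Q) = g • eG Q ∨ eG (g • Q) = -(g • eG Q) := fun g Q ↦ by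
    rcases map_geomSqrt (absoluteGaloisGroup.toAlgEquiv K g) d with h | h
    · exact Or.inl (untwistChain_smul_of_eq hd hWd hV hVW g h Q)
    · exact Or.inr (untwistChain_smul_of_eq_neg hd hWd hV hVW g h Q)
  obtain ⟨ψ, hψ, hψe⟩ := exists_addEquiv_geomTorsion_two_of_sign eG hsign
  refine ⟨ψ, hψ, fun E _ _ ⟨s, hs⟩ ↦ ?_⟩
  set L : localPoints (V.quadraticTwist d) E ≃+ localPoints V E :=
    (show localPoints (V.quadraticTwist d) E ≃+ localPoints V E from
      (VariableChange.pointEquiv ((V.quadraticTwist d).baseChange (AlgebraicClosure E))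
          ((untwist hd).map (closureEmb (K := K) E : AlgebraicClosure K →+* AlgebraicClosure E))).trans
        (Affine.Point.congrEquiv (untwist_map_closureEmb_smul V hd E))) with hL
  have hLsome : ∀ (x y : AlgebraicClosure E)
      (h : ((V.quadraticTwist d).baseChange (AlgebraicClosure E)).toAffine.Nonsingular x y),
      ∃ h', L (show localPoints (V.quadraticTwist d) E from .some x y h) =
        (show localPoints V E from .some ((closureEmb (K := K) E (geomSqrt d) ^ 2)⁻¹ * x)
          ((closureEmb (K := K) E (geomSqrt d) ^ 3)⁻¹ * y) h') :=
    fun x y h ↦ localUntwist_some V hd E h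
  set eL : localPoints Wd E ≃+ localPoints W E :=
    (((twistLocalIso E hWd).symm.trans (localPointsCongr E hVW)).trans L).trans (twistLocalIso E hV).symm
    with heL
  refine ⟨eL, fun σ Q ↦ ?_, fun t ↦ ?_⟩
  · simp only [heL, AddEquiv.trans_apply]
    rw [symm_equivariant (twistLocalIso E hWd) (twistLocalIso_smul E hWd) σ Q, localPointsCongr_smul,
      localUntwist_smul V E L hLsome hs σ,
      symm_equivariant (twistLocalIso E hV) (twistLocalIso_smul E hV) σ]
  · rw [hψe t]
    simp only [heG, heL, AddEquiv.trans_apply]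
    rw [pointsMap_twistPointsIso_symm hV E, pointsMap_untwistEquiv V hd E L hLsome,
      pointsMap_geomPointsCongr E hVW, pointsMap_twistPointsIso_symm hWd E]

end LocalSquare

/-! ## §7 Lemma 2.10 (i) for the local Kummer conditions `𝓛_E ≤ H¹(Γ_E, E[2](K̄))` -/

section Kummer

variable {K : Type u} [Field K] [NeZero (2 : K)]

/-- **MAZUR–RUBIN LEMMA 2.10 (i) in the Selmer-structure currency**: for `W/K` (`2 ≠ 0`), `d ≠ 0` and any model
`Wd = C • W^{(d)}` there are mutually inverse `Γ_K`-intertwining maps `φ : Wd[2] ⟶ W[2]`, `φ' : W[2] ⟶ Wd[2]`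
(Mazur–Rubin Remark 2.4) such that at EVERY `K`-field `E` in which `d` is a square the local Kummer condition of
`Wd`, transported along `H¹(φ|_{Γ_E}) : H¹(Γ_E, Wd[2]) → H¹(Γ_E, W[2])`, IS the local Kummer condition of `W`:
`(Wd.kummerLocalConditionAt 2 E).map H¹(φ|_{Γ_E}) = W.kummerLocalConditionAt 2 E` («if `v` splits in `F/K` then
`H¹_f(K_v, E^F[2]) = H¹_f(K_v, E[2])`»). This is the per-place agreement hypothesis of X11b's congruent-curve
transfer (`h𝓐`/`hcheck` of `CongruentTransfer.transport_kummer_agree_off`, `selmerGroup_sandwich_of_agree`) for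
the pair `(E, E^{(d)})` at `p = 2`, at the places split in `K(√d)` — in particular AT the prime `2` when `2`
splits, the place X11b's instrument leaves untyped. Proof: on cocycles, `H¹(φ|_{Γ_E})[f] = [ψ ∘ f]`, and a local
coboundary witness `Q ∈ Wd(K̄_E)` for `ι_* ∘ f` is carried to the witness `θ_E Q` for `ι_* ∘ ψ ∘ f` by the
`Γ_E`-equivariant local untwisting `θ_E` of `exists_addEquiv_geomTorsion_two_localSquare_of_sq`; symmetrically
for `φ'`. [cite: MazurRubin2010, Lemma 2.10 (i) and Remark 2.4] [cite: SilvermanAEC2009, X.5 Cor. 5.4, X.§4] -/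
theorem exists_intertwining_map_kummerLocalConditionAt_eq_of_sq (W : WeierstrassCurve K) {d : K} (hd : d ≠ 0)
    {Wd : WeierstrassCurve K} {C : VariableChange K} (hWd : C • W.quadraticTwist d = Wd) :
    ∃ (φ : (Wd.torsionGaloisModule (2 : ℤ)).toContRepresentation →ⁱL
        (W.torsionGaloisModule (2 : ℤ)).toContRepresentation)
      (φ' : (W.torsionGaloisModule (2 : ℤ)).toContRepresentation →ⁱL
        (Wd.torsionGaloisModule (2 : ℤ)).toContRepresentation),
      (∀ a, φ' (φ a) = a) ∧ (∀ b, φ (φ' b) = b) ∧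
      ∀ (E : Type u) [Field E] [Algebra K E], (∃ s : E, s ^ 2 = algebraMap K E d) →
        (Wd.kummerLocalConditionAt (2 : ℤ) E).map
            (galoisCohomology.map (φ.restrictField E) 1) =
          W.kummerLocalConditionAt (2 : ℤ) E := by
  obtain ⟨ψ, hψ, hloc⟩ := exists_addEquiv_geomTorsion_two_localSquare_of_sq W hd hWd
  have hψ' : ∀ (σ : absoluteGaloisGroup K) (Q : geomTorsion W (2 : ℤ)),
      ψ.symm (σ • Q) = σ • ψ.symm Q := fun σ Q ↦
    ψ.injective (by rw [hψ, ψ.apply_symm_apply, ψ.apply_symm_apply])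
  let φ : (Wd.torsionGaloisModule (2 : ℤ)).toContRepresentation →ⁱL
      (W.torsionGaloisModule (2 : ℤ)).toContRepresentation :=
    { toContinuousLinearMap := ⟨ψ.toAddMonoidHom.toIntLinearMap, continuous_of_discreteTopology⟩
      isIntertwining' := fun σ ↦ by
        ext P
        exact congrArg Subtype.val (hψ σ P) }
  let φ' : (W.torsionGaloisModule (2 : ℤ)).toContRepresentation →ⁱL
      (Wd.torsionGaloisModule (2 : ℤ)).toContRepresentation :=
    { toContinuousLinearMap := ⟨ψ.symm.toAddMonoidHom.toIntLinearMap, continuous_of_discreteTopology⟩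
      isIntertwining' := fun σ ↦ by
        ext Q
        exact congrArg Subtype.val (hψ' σ Q) }
  have hφ : ∀ a, φ a = ψ a := fun _ ↦ rfl
  have hφ' : ∀ b, φ' b = ψ.symm b := fun _ ↦ rfl
  refine ⟨φ, φ', fun a ↦ ψ.symm_apply_apply a, fun b ↦ ψ.apply_symm_apply b, fun E _ _ hsq ↦ ?_⟩
  obtain ⟨θ, hθ, hsquare⟩ := hloc E hsq
  have hsquare' : ∀ s : geomTorsion W (2 : ℤ),
      pointsMap Wd E (ψ.symm s : geomPoints Wd) = θ.symm (pointsMap W E (s : geomPoints W)) := fun s ↦ by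
    apply θ.injective
    rw [← hsquare (ψ.symm s), ψ.apply_symm_apply, θ.apply_symm_apply]
  have hθ' : ∀ (σ : absoluteGaloisGroup E) (Q : localPoints W E), θ.symm (σ • Q) = σ • θ.symm Q :=
    symm_equivariant θ hθ
  -- one inclusion, for an arbitrary intertwined datum (used twice: for `(ψ, θ)` and for `(ψ⁻¹, θ⁻¹)`)
  have key : ∀ {X Y : WeierstrassCurve K} (χ : (X.torsionGaloisModule (2 : ℤ)).toContRepresentation →ⁱL
        (Y.torsionGaloisModule (2 : ℤ)).toContRepresentation) (η : localPoints X E ≃+ localPoints Y E),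
      (∀ (σ : absoluteGaloisGroup E) (Q : localPoints X E), η (σ • Q) = σ • η Q) →
      (∀ t : geomTorsion X (2 : ℤ), pointsMap Y E (χ t : geomPoints Y) = η (pointsMap X E (t : geomPoints X))) →
      ∀ x ∈ X.kummerLocalConditionAt (2 : ℤ) E,
        galoisCohomology.map (χ.restrictField E) 1 x ∈ Y.kummerLocalConditionAt (2 : ℤ) E := by
    intro X Y χ η hη hχ x hx
    obtain ⟨f, rfl⟩ := oneCocycleClass_surjective
      (DiscreteGaloisModule.toTopRep (GaloisRep.restrictField E (X.torsionGaloisModule (2 : ℤ)))) x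
    rw [mem_kummerLocalConditionAt_iff, map_torsionPointsMapIntertwining_oneCocycleClass] at hx
    obtain ⟨Q, hQ⟩ := (oneCocycleClass_eq_zero_iff _ _).mp hx
    have hQ' : ∀ σ : absoluteGaloisGroup E,
        pointsMap X E ((f.1 σ : geomTorsion X (2 : ℤ)) : geomPoints X) = σ • Q - Q := hQ
    rw [galoisCohomology.map_one_oneCocycleClass, mem_kummerLocalConditionAt_iff,
      map_torsionPointsMapIntertwining_oneCocycleClass]
    refine (oneCocycleClass_eq_zero_iff _ _).mpr ⟨η Q, fun σ ↦ ?_⟩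
    change pointsMap Y E ((χ (f.1 σ) : geomTorsion Y (2 : ℤ)) : geomPoints Y) = σ • η Q - η Q
    rw [hχ, hQ', map_sub, hη]
  apply le_antisymm
  · rw [AddSubgroup.map_le_iff_le_comap]
    intro x hx
    exact key φ θ hθ (fun t ↦ by rw [hφ]; exact hsquare t) x hx
  · intro y hy
    refine ⟨galoisCohomology.map (φ'.restrictField E) 1 y,
      key φ' θ.symm hθ' (fun s ↦ by rw [hφ']; exact hsquare' s) y hy, ?_⟩
    -- `H¹(φ|_E) (H¹(φ'|_E) y) = y`
    obtain ⟨f, rfl⟩ := oneCocycleClass_surjective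
      (DiscreteGaloisModule.toTopRep (GaloisRep.restrictField E (W.torsionGaloisModule (2 : ℤ)))) y
    rw [galoisCohomology.map_one_oneCocycleClass, galoisCohomology.map_one_oneCocycleClass]
    congr 1
    apply Subtype.ext
    ext g : 1
    rw [contOneCocycles.pullback_apply, contOneCocycles.pullback_apply]
    exact ψ.apply_symm_apply (f.1 g)

end Kummer

end Summit.BirchSwinnertonDyer.BirchSwinnertonDyer.Theorems.GenusKolyTwistLocal

end
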